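import Mathlib
import HarnessLib
import Summits.NavierStokesRegularity.NavierStokesRegularity.Theses.QuarterBudgetTrace
import Summits.NavierStokesRegularity.NavierStokesRegularity.Theorems.QuarterBudgetTraceBudgetedExtinctApex
import Summits.NavierStokesRegularity.NavierStokesRegularity.Theorems.QuarterBudgetTraceNoBudgetedExtinctApex

/-!
# `QuarterBudgetTrace.Assembly` (item stmt-NavierStokesRegularity-26016) and the route modulo its two
  open cruxes

* `quarterBudgetTrace_assembly_proof : Assembly` — pure logic: `Assembly` is
  `EnstrophyQuarterLaw → NoTraceConcentration → BudgetedExtinctApex → NoBudgetedExtinctApex →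
  NavierStokesRegularity`, i.e. the type of the route's planner-authored deciding theorem
  `Theses.QuarterBudgetTrace.closes` (kernel-checked in the route file); this item is that composition
  BY NAME (candidate attached to the item by refuter ref1 g15, 2026-08-28T07:25Z, landed here).
* `quarterBudgetTrace_of_cruxes : EnstrophyQuarterLaw → NoTraceConcentration → NavierStokesRegularity` —
  the route with its two PROVED supports plugged in by name
  (`QuarterBudgetTraceBudgetedExtinctApex.budgetedExtinctApex`, item 26014;
  `QuarterBudgetTraceNoBudgetedExtinctApex.noBudgetedExtinctApex`, item 26015): after this file the
  route's conclusion depends on EXACTLY its two open cruxes, the enstrophy quarter law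
  `EnstrophyQuarterLaw` (stmt-1574) and the energy-flat terminal trace `NoTraceConcentration`
  (stmt-18381).

HONEST FRAMING: bookkeeping; `NavierStokesRegularity` is NOT proved here (it is reduced to two OPEN
statements, both of crux grade); nothing in this file bears on the truth of Navier–Stokes regularity.
-/

noncomputable section

set_option linter.dupNamespace false

namespace Summit.NavierStokesRegularity.NavierStokesRegularity.Theorems

open Summit.NavierStokesRegularity.NavierStokesRegularity.Theses.QuarterBudgetTrace

/-- **Item stmt-NavierStokesRegularity-26016** (`QuarterBudgetTrace.Assembly`): the four items compose
to the problem statement — by the route's own kernel-checked deciding theorem `closes`. [folklore] -/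
theorem quarterBudgetTrace_assembly_proof :
    Summit.NavierStokesRegularity.NavierStokesRegularity.Theses.QuarterBudgetTrace.Assembly := by
  unfold Summit.NavierStokesRegularity.NavierStokesRegularity.Theses.QuarterBudgetTrace.Assembly
  exact fun hQ hN hA hX => closes hQ hN hA hX

/-- **The route modulo its cruxes**: with the supports `BudgetedExtinctApex` (item 26014) and
`NoBudgetedExtinctApex` (item 26015) proved in the tree, the two OPEN cruxes `EnstrophyQuarterLaw`
(stmt-1574) and `NoTraceConcentration` (stmt-18381) alone imply the problem statement. [folklore] -/
theorem quarterBudgetTrace_of_cruxes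
    (hQ : Summit.NavierStokesRegularity.NavierStokesRegularity.Theses.QuarterBudgetTrace.EnstrophyQuarterLaw)
    (hN : Summit.NavierStokesRegularity.NavierStokesRegularity.Theses.QuarterBudgetTrace.NoTraceConcentration) :
    NavierStokesRegularity :=
  closes hQ hN QuarterBudgetTraceBudgetedExtinctApex.budgetedExtinctApex
    QuarterBudgetTraceNoBudgetedExtinctApex.noBudgetedExtinctApex

end Summit.NavierStokesRegularity.NavierStokesRegularity.Theorems

end
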